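import Summits.QuantumFields.YangMills.Theorems.UnitScaleTiltMinimiserStabilityRegPrThm1Induction
import HarnessLib

/-!
# Route `UnitScaleTilt`, crux K1 child «MinimiserStabilityRegPr» (stmt-QuantumFields-19200), registered stub `stub_variational` (v3d 511ba6194f4d04b9):
# ATTAINMENT OVER (6)(ε₀) FROM THEOREM 1 (8) AND THE GLOBAL MINIMALITY OF THE (8)-MINIMISER; the stub from Prop 7-from-(14), Prop 8, Sect. F
# and the located gap G-K1aR-2 (`InfSixOfEightAt`, print's (142)) BY NAME

Cell `ym3-torus` ∕ fleet seat `ym-ust-19200-p1` (HUMAN RULING D-0037, YM ladder rung R3).  Bookkeeping only: the located schema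
`T3ExistSplit.MinSixAttainedAt` (attainment of the infimum of the Wilson action over print's regular fibre (6)(ε₀)) follows from [Balaban1985Variational]
Thm 1 (8) (`T3PrintedMinimiserExistence.Thm1MinimalIn8At`: a minimiser over (8) exists) and the located gap G-K1aR-2 (`InfSixOfEightAt`: it minimises
over (6)(ε₀) — print's expansion (142) p. 299 with Sect. C's bounds on the whole chart), the witness being the (8)-minimiser itself (`(8) ⊆ (6)(ε₀)`
for `B₃ε₁ ≤ ε₀`).  With the sibling `Variational.thm1At_fam_of_prop7_prop8_sectF` (Theorem 1 at the carriers from Prop 7-from-(14), Prop 8, Sect. F)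
the registered body of `stub_variational` therefore rests on exactly FOUR named statements about the (0.4)-averaging variational problem of the family:
Prop 7 from a background (14), `B11.Prop8Printed`, `B11.SectFPrinted`, `InfSixOfEightAt` — **`stub_variational_of_leaves'`**.

References: T. Bałaban, CMP 102 (1985) 277–309 [Balaban1985Variational] (Thm 1 (8) p.279, Prop 7 and (142) p.299, Prop 8 p.304, Sect. F (169) p.305).
-/

noncomputable section

namespace Summit.QuantumFields.YangMills.Theorems.Variational

open Literature.MathematicalPhysics.QuantumFieldTheory.Balaban1983to89
open T3ContinuumYM3Torus T3LowerAlongMinimisersSplit T3AvgDivergenceSplit T3ExistSplit T3Thm1Carrier T3PrintedMinimiserExistence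
open B11 (Prop8Printed SectFPrinted)
open B11Thm1 (Thm1At)

/-- **ATTAINMENT OVER (6)(ε₀) ⇐ THM 1 (8) ∧ G-K1aR-2**: if a minimiser over the small space (8)(B₃ε₁) exists (`Thm1MinimalIn8At`) and minimises over
the big space (6)(ε₀) for `B₃ε₁ ≤ ε₀ ≤ a₀` (`InfSixOfEightAt`), then the infimum over (6)(ε₀) is attained — at that minimiser, which lies in
(6)(ε₀) by `(8) ⊆ (6)(ε₀)`. [cite: Balaban1985Variational, Thm 1 (8) p.279 and (142) p.299] -/
theorem minSixAttainedAt_of_infSixOfEight {L : ℕ} {a₀ a₁ B₃ : ℝ} (h8 : Thm1MinimalIn8At L a₁ B₃) (h68 : InfSixOfEightAt L a₀ a₁ B₃) :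
    MinSixAttainedAt L a₀ a₁ B₃ := by
  intro F hF n K hnK ε₁ ε₀ hε₁ hε₁a hlo hhi V hV
  obtain ⟨U, hU8, hmin8⟩ := h8 F hF n K hnK ε₁ hε₁ hε₁a V hV
  exact ⟨U, regFibrePr_mono F hlo V hU8, h68 F hF n K hnK ε₁ ε₀ hε₁ hε₁a hlo hhi V hV U hU8 hmin8⟩

/-- `Thm1MinimalIn8At` is antitone in `a₁` (only the window shrinks). [cite: Balaban1985Variational, Thm 1 (8) p.279] -/
theorem thm1MinimalIn8At_anti {L : ℕ} {a₁ a₁' B₃ : ℝ} (ha : a₁' ≤ a₁) (h8 : Thm1MinimalIn8At L a₁ B₃) : Thm1MinimalIn8At L a₁' B₃ :=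
  fun F hF n K hnK ε₁ hε₁ hε₁a V hV => h8 F hF n K hnK ε₁ hε₁ (hε₁a.trans ha) V hV

/-- `InfSixOfEightAt` is antitone in `a₁`. [cite: Balaban1985Variational, (142) p.299] -/
theorem infSixOfEightAt_anti {L : ℕ} {a₀ a₁ a₁' B₃ : ℝ} (ha : a₁' ≤ a₁) (h : InfSixOfEightAt L a₀ a₁ B₃) : InfSixOfEightAt L a₀ a₁' B₃ :=
  fun F hF n K hnK ε₁ ε₀ hε₁ hε₁a hlo hhi V hV U hU hmin => h F hF n K hnK ε₁ ε₀ hε₁ (hε₁a.trans ha) hlo hhi V hV U hU hmin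

/-- **THE REGISTERED BODY OF `stub_variational` FROM FOUR NAMED STATEMENTS** (at every admissible block size `L`, some `B₃ > 4`): Prop 7 from a
background (14) (`O₁ ≥ 1`, `C₁ = L³`), `B11.Prop8Printed B₃ (famX L)`, `B11.SectFPrinted B₃ (famX L)` — which give Theorem 1 at the carriers by the
Sect. A induction (`thm1At_fam_of_prop7_prop8_sectF`), in particular Thm 1 (8) — and the located gap G-K1aR-2 `InfSixOfEightAt L â₀ â₁ B₃` at some
window (print's (142)): attainment over (6)(ε₀) follows (`minSixAttainedAt_of_infSixOfEight`) and `stub_variational_of_printed` assembles the body.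
[cite: Balaban1985Variational, Thm 1 p.279, Prop 7 and (142) p.299, Prop 8 p.304, Sect. F (169) p.305] -/
theorem stub_variational_of_leaves'
    (hyp : ∀ L : ℕ, 1 < L → ∃ B₃ : ℝ, 4 < B₃ ∧
      (∃ a₀ a₁' O₁ : ℝ, 0 < a₀ ∧ 0 < a₁' ∧ 1 ≤ O₁ ∧ ∀ (i : Idx L) (ε₀ ε₁ : ℝ), 0 < ε₁ → ∀ V : (famX L i).Bdry, (famX L i).Reg7 ε₁ V →
        ∀ U₀ : (famX L i).Cfg, (famX L i).InU ((L : ℝ) ^ 3 * B₃ * ε₁) U₀ → (famX L i).InB V U₀ →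
          (ε₀ ≤ a₀ → B₃ * ε₁ ≤ ε₀ → (famX L i).AtMostOneCriticalOrbit ε₀ V) ∧
          (ε₁ ≤ a₁' → ∃ U : (famX L i).Cfg, (famX L i).OnMinimalOrbit (O₁ * (L : ℝ) ^ 3 * B₃ * ε₁) V U)) ∧
      Prop8Printed B₃ (famX L) ∧ SectFPrinted B₃ (famX L) ∧ ∃ â₀ â₁ : ℝ, 0 < â₀ ∧ 0 < â₁ ∧ InfSixOfEightAt L â₀ â₁ B₃) :
    ∀ (L : ℕ), ∃ a₀ a₁ B₃ B₄ : ℝ, 0 < a₀ ∧ 0 < a₁ ∧ 0 < B₃ ∧ 0 < B₄ ∧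
      MinSixAttainedAt L a₀ a₁ B₃ ∧ MinimisersIn8At L a₀ a₁ B₃ ∧ MinimiserCurvGradAt L a₀ a₁ B₃ B₄ := by
  refine stub_variational_of_printed fun L hL => ?_
  obtain ⟨B₃, hB₃, H7, H8, HF, â₀, â₁, hâ₀, hâ₁, h68⟩ := hyp L hL
  obtain ⟨C, hCB, hM, H⟩ := thm1At_fam_of_prop7_prop8_sectF hL hB₃ H7 H8 HF
  subst hCB
  -- Thm 1 (8) at the carriers, then attainment at the window `min â₁ C.a₁`
  have h8 : Thm1MinimalIn8At L C.a₁ C.B₃ := thm1MinimalIn8At_of_thm1At C H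
  have hatt : MinSixAttainedAt L â₀ (min â₁ C.a₁) C.B₃ :=
    minSixAttainedAt_of_infSixOfEight (thm1MinimalIn8At_anti (min_le_right _ _) h8) (infSixOfEightAt_anti (min_le_left _ _) h68)
  exact ⟨C, H, hM, H8, â₀, min â₁ C.a₁, hâ₀, lt_min hâ₁ C.a₁_pos, hatt⟩

end Summit.QuantumFields.YangMills.Theorems.Variational

end
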